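import Summits.AtomisticToContinuum.HydrodynamicLimit.Theorems.TwoClocksEntropyToHydro
import Summits.AtomisticToContinuum.HydrodynamicLimit.Theses.ImplosionDichotomy

/-!
# The in-band entropy dock: the GUARDED Yau target implies `HydroLimitInBand` (crux stmt-9133)

Line `IdeatorOneSketch` (card `in-band-entropy-clock`) of the crux
`Summit.AtomisticToContinuum.HydrodynamicLimit.Theses.ImplosionDichotomy.HydroLimitInBand`, stub
`stub_dock`, in UNFOLDED form: the packing-guarded hydrodynamic limit (`∃ η₀` outermost; the
conclusion of `HydrodynamicLimit` asked only for classical hs-Euler solutions with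
`ρ_t(x) σ³ < η₀` on `[0,T) × 𝕋³`) follows from the GUARDED Yau target — route TwoClocks' typed
target `RelEntropyVanishing` (stmt-AtomisticToContinuum-0766) with the same packing guard inserted
after `IsHardSphereEulerSolution σ T ρ u θ →` — with the SAME `η₀` and the SAME `σ₀`, by the landed
entropy-inequality step `Theorems.tendstoHydroFieldsAt_of_klDiv`
(`Theorems/TwoClocksEntropyToHydro.lean`) at each `t < T`. THE GUARD COMMUTES WITH THE ENTROPY
CLOCK: the proof is that of `Theorems.hydrodynamicLimit_of_relEntropyVanishing` with the guard
hypothesis threaded through unchanged.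

* `hydroLimitInBand_of_relEntropyVanishingInBand` — the dock (hypothesis = the body of the line's
  `RelEntropyVanishingInBand`, verbatim; conclusion = the crux decl BY NAME).

prover-line-stmt-AtomisticToContinuum-9133-0 (supports stmt-AtomisticToContinuum-9133; the lead
turns it into the one-line stub `stub_dock : EntropyDockInBand` of the skeleton).
-/

noncomputable section

open MeasureTheory Filter Set Topology InformationTheory
open scoped ENNReal

namespace Summit.AtomisticToContinuum.HydrodynamicLimit.Theorems

open Literature.MathematicalPhysics.KineticTheory Literature.Analysis.FluidPDE

/-- **The in-band entropy dock `RelEntropyVanishingInBand → HydroLimitInBand`** (the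
entropy-inequality glue of the relative-entropy method, run inside the packing band; Yau 1991,
Olla–Varadhan–Yau 1993 §3, Kipnis–Landim 1999 Ch. 6). The hypothesis is, verbatim, the GUARDED
Yau target of line `IdeatorOneSketch`: `∃ η₀ > 0` such that for all continuous positive profiles
there is `σ₀` such that for `0 < σ < σ₀`, every classical hs-Euler solution on `[0,T)` WITH
`ρ_t(x) σ³ < η₀` on `[0,T) × 𝕋³` and every flow family, the initial local Gibbs laws are
probability measures and, if their fields converge at `t = 0`, then for every `t < T` some
activity profile `a_t` makes the reference local Gibbs law `(a_t, u_t, θ_t)` a probability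
measure whose empirical fields concentrate exponentially around `(ρ, ρu, E)(t)` while
`KL(lawAt Φ_N λ_N t ‖ reference)/(N+1) → 0`. The conclusion is the packing-guarded conjunct
`ImplosionDichotomy.HydroLimitInBand` (stmt-AtomisticToContinuum-9133) with the same `η₀` and the
same `σ₀`: at each `t < T` apply `tendstoHydroFieldsAt_of_klDiv`. [cite: Yau1991, §2] -/
theorem hydroLimitInBand_of_relEntropyVanishingInBand :
    (∃ η₀ : ℝ, 0 < η₀ ∧ ∀ (a₀ θ₀ : T3 → ℝ) (u₀ : T3 → V3), Continuous a₀ → Continuous θ₀ →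
      Continuous u₀ → (∀ x, 0 < a₀ x) → (∀ x, 0 < θ₀ x) → ∃ σ₀ : ℝ, 0 < σ₀ ∧ ∀ σ : ℝ, 0 < σ →
      σ < σ₀ → ∀ (T : ℝ) (ρ θ : ℝ → T3 → ℝ) (u : ℝ → T3 → V3), IsHardSphereEulerSolution σ T ρ u θ →
      (∀ t ∈ Set.Ico 0 T, ∀ x, ρ t x * σ ^ 3 < η₀) →
      ∀ Φ : (N : ℕ) → HardSphereFlow (Torus.geometry (Fin 3)) (hsDiameter σ N) (N + 1),
      (∀ N, IsProbabilityMeasure (localGibbsLaw σ a₀ u₀ θ₀ N (Φ N))) ∧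
      (TendstoHydroFieldsAt (fun N => localGibbsLaw σ a₀ u₀ θ₀ N (Φ N)) Φ ρ u θ 0 →
        ∀ t ∈ Set.Ico 0 T, ∃ a : T3 → ℝ,
        (∀ N, IsProbabilityMeasure (localGibbsLaw σ a (u t) (θ t) N (Φ N))) ∧
        (∀ χ : T3 → ℝ, Continuous χ → ∀ δ : ℝ, 0 < δ → ∃ C : ℝ, 0 < C ∧ ∀ N : ℕ,
          localGibbsLaw σ a (u t) (θ t) N (Φ N)
              {z | δ < |empiricalDensityField z χ - ∫ x, χ x * ρ t x|} ≤
            ENNReal.ofReal (C * Real.exp (-(C⁻¹ * (N + 1)))) ∧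
          localGibbsLaw σ a (u t) (θ t) N (Φ N)
              {z | δ < ‖empiricalMomentumField z χ - ∫ x, (χ x * ρ t x) • u t x‖} ≤
            ENNReal.ofReal (C * Real.exp (-(C⁻¹ * (N + 1)))) ∧
          localGibbsLaw σ a (u t) (θ t) N (Φ N)
              {z | δ < |empiricalEnergyField z χ -
                ∫ x, χ x * totalEnergyDensity (ρ t x) (u t x) (θ t x)|} ≤
            ENNReal.ofReal (C * Real.exp (-(C⁻¹ * (N + 1))))) ∧
        Tendsto (fun N : ℕ => klDiv ((Φ N).lawAt (localGibbsLaw σ a₀ u₀ θ₀ N (Φ N)) t)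
          (localGibbsLaw σ a (u t) (θ t) N (Φ N)) / ((N : ℝ≥0∞) + 1)) atTop (𝓝 0))) →
    Summit.AtomisticToContinuum.HydrodynamicLimit.Theses.ImplosionDichotomy.HydroLimitInBand := by
  rintro ⟨η₀, hη₀, H⟩
  refine ⟨η₀, hη₀, ?_⟩
  intro a₀ θ₀ u₀ ha hθ hu ha0 hθ0
  obtain ⟨σ₀, hσ₀, G⟩ := H a₀ θ₀ u₀ ha hθ hu ha0 hθ0
  refine ⟨σ₀, hσ₀, fun σ hσ hσ' T ρ θ u hE hguard Φ h0 t ht => ?_⟩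
  obtain ⟨hprob, hmain⟩ := G σ hσ hσ' T ρ θ u hE hguard Φ
  obtain ⟨a, hψ, hconc, hkl⟩ := hmain h0 t ht
  exact tendstoHydroFieldsAt_of_klDiv (a := a) Φ hconc hkl

end Summit.AtomisticToContinuum.HydrodynamicLimit.Theorems

end
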